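import Summits.RiemannHypothesis.RiemannHypothesis.Theorems.IntegerScrewCensusFloor80B

/-!
# Route `IntegerScrew` — census cell `M080-T305-dd` in the kernel: the DUAL checker on the cells `48 ≤ c < 77` (part C)

KERNEL FACTS (`decide +kernel`): `dualCheckW 79 305 40 EB 6000 a b … = true` on sub-ranges of `[48, 77)` for the dual
certificate literal `dpats80/deps80` of `IntegerScrewCensusFloor80A`.  RH-free; nothing here bears on the truth of RH.
-/

set_option linter.dupNamespace false
set_option autoImplicit false

namespace Summit.RiemannHypothesis.RiemannHypothesis.Theorems.IntegerScrew.Manifest.Fast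

open Literature.Analysis.ValidatedNumerics Literature.Analysis.ValidatedNumerics.Numerics

set_option maxRecDepth 200000 in
set_option maxHeartbeats 0 in
/-- KERNEL FACT: the cells `48 ≤ c < 64` pass. -/
theorem dualCheckW_80_48_64 : dualCheckW 79 305 40 EB 6000 48 64 RungCert.logs127 dpats80 deps80 = true := by
  decide +kernel

set_option maxRecDepth 200000 in
set_option maxHeartbeats 0 in
/-- KERNEL FACT: the cells `64 ≤ c < 77` pass. -/
theorem dualCheckW_80_64_77 : dualCheckW 79 305 40 EB 6000 64 77 RungCert.logs127 dpats80 deps80 = true := by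
  decide +kernel

/-- The cells `0 ≤ c < 32` pass. -/
theorem dualCheckW_80_0_32j : dualCheckW 79 305 40 EB 6000 0 32 RungCert.logs127 dpats80 deps80 = true :=
  dualCheckW_join (by norm_num) (by norm_num) dualCheckW_80_0_16 dualCheckW_80_16_32

/-- The cells `0 ≤ c < 48` pass. -/
theorem dualCheckW_80_0_48j : dualCheckW 79 305 40 EB 6000 0 48 RungCert.logs127 dpats80 deps80 = true :=
  dualCheckW_join (by norm_num) (by norm_num) dualCheckW_80_0_32j dualCheckW_80_32_48

/-- The cells `0 ≤ c < 64` pass. -/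
theorem dualCheckW_80_0_64j : dualCheckW 79 305 40 EB 6000 0 64 RungCert.logs127 dpats80 deps80 = true :=
  dualCheckW_join (by norm_num) (by norm_num) dualCheckW_80_0_48j dualCheckW_80_48_64

/-- The cells `0 ≤ c < 77` pass. -/
theorem dualCheckW_80 : dualCheckW 79 305 40 EB 6000 0 77 RungCert.logs127 dpats80 deps80 = true :=
  dualCheckW_join (by norm_num) (by norm_num) dualCheckW_80_0_64j dualCheckW_80_64_77

/-- **`T_DD(80) > 305`**: NO manifest certificate of `S_80` with frequencies in `[1/10, 305]` exists (census floor,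
refuted side, by the dual certificate). -/
theorem censusFloor_80 : ¬ ManifestCert 79 (1 / 10) 305 := by
  have h := not_manifestCert_of_check dualLight_80 dualCheckW_80 size_80 (fun m _ hm => logs127_mem (n := 79) (by norm_num) m hm)
    (utabNN_ok (by norm_num)) CL10000_le le_CH10000
  exact_mod_cast h

end Summit.RiemannHypothesis.RiemannHypothesis.Theorems.IntegerScrew.Manifest.Fast
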